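import Summits.RiemannHypothesis.RiemannHypothesis.Theorems.WeilFormatCCinfFactsEvenTruncA
import HarnessLib

/-!
# Format C, design C∞: NAMES for the even sector's row families, profile table and row remainder (cut at power `E₀`)

Route context: Fourier–Galerkin / Schur-complement certificates of Weil positivity on a window ("format C", C∞ door;
cell memo `run/shared/lean/pub/rh-explicit/rh-explicit-weil-10/KERNEL-LEVER.md` §22–§23; supporting stmt-RiemannHypothesis-0098;
seat rh-explicit-weil-10).  `cinf_facts_even_truncA` (`WeilFormatCCinfFactsEvenTruncA`) proves the C∞ doors' hypotheses
`hρrowe ∧ hrowe ∧ hVe ∧ hWe` for EXPLICIT printed functions `Prowe`, `ρrowe`, `Rtabe` (multi-kilobyte lambdas).  The rung's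
data side (rh-explicit-weil-2's exact-integer stage pipeline `CinfStageE.SR …` and the `TabNear` validators of the
tables `PR`, `RT`, `RR`) must name the SAME functions.  This file gives them names, so that every downstream statement carries
an identifier instead of the printed lambda and the door's `_`-slots unify syntactically:

* `CinfFam.prowRawE` — the (tag, power) coefficient of the block row `n` (un-rescaled), with the per-tag
  projections `prowRawE_tag0/1/2/3` (`rfl`): tag 0 = the pure fiber sum boxed by `CinfCoeff.mem_evenRowPureBox`, tag 3 = the
  `S_m` fiber sum of `CinfCoeff.mem_evenRowSinBox`, tags 1, 2 = 0;
* `CinfFam.prowE` — the door's `Prowe` (rescaled and truncated: `raw(t, e+1)/m₀^{e+1}`), `prowE_apply`;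
* `CinfFam.rtabRawE`, `CinfFam.rtabE` — the door's `Rtabe`, `rtabE_apply`, `rtabRawE_tag0`;
* `CinfFam.rhoRowE` — the door's `ρrowe` (analytic remainder + truncation tail), `rhoRowE_eq`;
* `cinf_facts_even_truncA_fam` — `cinf_facts_even_truncA` RESTATED through the names (same hypotheses, same order).

Definitions are verbatim copies of the printed lambdas (generated from the tree file by
`HOME/rh-explicit-weil-10/lean/gen12/gen/make_famdefs.py`); proofs `rfl` / `exact`.  Standard axioms; no RH claim.
-/

set_option autoImplicit false
-- `Summit.RiemannHypothesis.RiemannHypothesis.…` is the layout-mandated namespace (summit = problem name).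
set_option linter.dupNamespace false

noncomputable section

open Complex Filter Set MeasureTheory Finset
open scoped Real Topology ComplexConjugate ArithmeticFunction.vonMangoldt

namespace Summit.RiemannHypothesis.RiemannHypothesis.Theorems.WeilFormatC

open Literature.NumberTheory.LFunctions Literature.NumberTheory.LFunctions.Yoshida1992
  Literature.Analysis.SpecialFunctions

namespace CinfFam

/-- The (tag, power)-coefficient function of the even block row `n` BEFORE rescaling/truncation
(`abs_evenRow_sub_family_le`): `prowRawE a ν K R J n t d` = coefficient of `T_t/m^d`. -/
def prowRawE (a : ℝ) (ν K R J : ℕ) (n : ℕ) : Fin 4 → ℕ → ℝ :=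
  fun t d ↦ (![fun d : ℕ ↦ (∑ j ∈ (Finset.range J).filter (fun j ↦ (2 * j + 1) = d),
                π / 4 * ((-1 : ℝ) ^ n * (n : ℝ) ^ (2 * j)) / Real.pi)
              + (∑ p ∈ (Finset.Icc 1 K ×ˢ Finset.range J).filter (fun p ↦ p.1 + (2 * p.2 + 1) = d),
                  (fun N : ℕ ↦ (if N % 4 = 1 then (1 : ℝ) else if N % 4 = 3 then -1 else 0)
              * (1 - 1 / (2 * (N : ℝ))
                  - (∑ l ∈ Finset.Icc 1 ν, (bernoulli (2 * l) : ℝ) / (2 * l) * 16 ^ l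
                      * (((N - 1).choose (2 * l - 1) : ℕ) : ℝ)) / 2)
              * (a / (2 * π)) ^ N) p.1
                    * ((-1 : ℝ) ^ n * (n : ℝ) ^ (2 * p.2)) / Real.pi)
              - (∑ p ∈ (Finset.range R ×ˢ Finset.range J).filter (fun p ↦ (2 * p.1 + 1) + (2 * p.2 + 1) = d),
                  (fun r : ℕ ↦ (-1 : ℝ) ^ r *
              (∑' l : ℕ, Real.exp (-(2 * a * digammaNode l)) * digammaNode l ^ (2 * r)) * (a / π) ^ (2 * r + 1)) p.1
                    * ((-1 : ℝ) ^ n * (n : ℝ) ^ (2 * p.2)) / Real.pi)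
              + (∑ r ∈ (Finset.range J).filter (fun r ↦ (2 * r + 2) = d),
                  (fun r : ℕ ↦ (-1 : ℝ) ^ n *
              (-((n : ℝ) ^ (2 * r + 1)) * ((Complex.digamma (1 / 4 + ((freq a n : ℝ) : ℂ) / 2 * I)).im / 2
                  + (∑ k ∈ weilPrimeIndex a, (Λ k : ℝ) / Real.sqrt k * Real.sin (freq a n * Real.log k))
                  - archExpSumSin a n) / π
                + 4 / a * (Real.exp (a / 2) - Real.exp (-(a / 2))) ^ 2 * (-1 : ℝ) ^ r * (a ^ 2 / (4 * π ^ 2)) ^ (r + 1)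
                  * (1 / (1 + 4 * freq a n ^ 2)))) r),
                fun _ ↦ 0, fun _ ↦ 0,
                fun d : ℕ ↦ ∑ j ∈ (Finset.range J).filter (fun j ↦ (2 * j + 1) = d),
                ((-1 : ℝ) ^ n * (n : ℝ) ^ (2 * j)) / Real.pi] t) d

/-- The door's `Prowe` for the truncated rescaled families over `Fin 4 × Fin E₀` (verbatim from `cinf_facts_even_truncA`). -/
def prowE (a : ℝ) (ν K R J E₀ m₀ : ℕ) : ℕ → Fin 4 × Fin E₀ → ℝ :=
  fun (n : ℕ) (x : Fin 4 × Fin E₀) ↦ ((![fun d : ℕ ↦ (∑ j ∈ (Finset.range J).filter (fun j ↦ (2 * j + 1) = d),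
                π / 4 * ((-1 : ℝ) ^ n * (n : ℝ) ^ (2 * j)) / Real.pi)
              + (∑ p ∈ (Finset.Icc 1 K ×ˢ Finset.range J).filter (fun p ↦ p.1 + (2 * p.2 + 1) = d),
                  (fun N : ℕ ↦ (if N % 4 = 1 then (1 : ℝ) else if N % 4 = 3 then -1 else 0)
              * (1 - 1 / (2 * (N : ℝ))
                  - (∑ l ∈ Finset.Icc 1 ν, (bernoulli (2 * l) : ℝ) / (2 * l) * 16 ^ l
                      * (((N - 1).choose (2 * l - 1) : ℕ) : ℝ)) / 2)
              * (a / (2 * π)) ^ N) p.1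
                    * ((-1 : ℝ) ^ n * (n : ℝ) ^ (2 * p.2)) / Real.pi)
              - (∑ p ∈ (Finset.range R ×ˢ Finset.range J).filter (fun p ↦ (2 * p.1 + 1) + (2 * p.2 + 1) = d),
                  (fun r : ℕ ↦ (-1 : ℝ) ^ r *
              (∑' l : ℕ, Real.exp (-(2 * a * digammaNode l)) * digammaNode l ^ (2 * r)) * (a / π) ^ (2 * r + 1)) p.1
                    * ((-1 : ℝ) ^ n * (n : ℝ) ^ (2 * p.2)) / Real.pi)
              + (∑ r ∈ (Finset.range J).filter (fun r ↦ (2 * r + 2) = d),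
                  (fun r : ℕ ↦ (-1 : ℝ) ^ n *
              (-((n : ℝ) ^ (2 * r + 1)) * ((Complex.digamma (1 / 4 + ((freq a n : ℝ) : ℂ) / 2 * I)).im / 2
                  + (∑ k ∈ weilPrimeIndex a, (Λ k : ℝ) / Real.sqrt k * Real.sin (freq a n * Real.log k))
                  - archExpSumSin a n) / π
                + 4 / a * (Real.exp (a / 2) - Real.exp (-(a / 2))) ^ 2 * (-1 : ℝ) ^ r * (a ^ 2 / (4 * π ^ 2)) ^ (r + 1)
                  * (1 / (1 + 4 * freq a n ^ 2)))) r),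
                fun _ ↦ 0, fun _ ↦ 0,
                fun d : ℕ ↦ ∑ j ∈ (Finset.range J).filter (fun j ↦ (2 * j + 1) = d),
                ((-1 : ℝ) ^ n * (n : ℝ) ^ (2 * j)) / Real.pi] x.1) ((x.2 : ℕ) + 1) / (m₀ : ℝ) ^ ((x.2 : ℕ) + 1))

/-- The door's `ρrowe`: analytic remainder at orders `(ν, K, R, J)` plus the truncation tail beyond power `E₀`
(verbatim from `cinf_facts_even_truncA`). -/
def rhoRowE (a : ℝ) (ν K R J D E₀ m₀ : ℕ) : ℕ → ℝ :=
  fun n : ℕ ↦ (((4 * Real.pi ^ 2 / 3 * ((2 * ν + 1).factorial : ℝ) / (2 * Real.pi) ^ (2 * ν + 1)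
                * (4 * (1 / (4 * (π * m₀ / a / 2)))) ^ (2 * ν)
              + (1 / (4 * (π * m₀ / a / 2))) ^ (K + 1) / ((K + 1) * (1 - 1 / (4 * (π * m₀ / a / 2))))
              + 2 * (1 / (4 * (π * m₀ / a / 2))) ^ (K + 1)
              + ∑ k ∈ Finset.Icc 1 ν, |(bernoulli (2 * k) : ℝ) / (2 * k)| * 2 ^ (K + 1 + 4 * k)
                  * (1 / (4 * (π * m₀ / a / 2))) ^ (K + 1)) / 2
            + (∑' k : ℕ, Real.exp (-(2 * a * digammaNode k)) * digammaNode k ^ (2 * R))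
                / |π * m₀ / a| ^ (2 * R + 1)) / π
            * ∑ j ∈ Finset.range J, (n : ℝ) ^ (2 * j) / (m₀ : ℝ) ^ (2 * j + 1)
          + (2 * (π / 4 + (∑ k ∈ weilPrimeIndex a, (Λ k : ℝ) / Real.sqrt k) + a * (1 + weilArchDensity (2 * a)) / π)
                * (n : ℝ) ^ (2 * J) / π
              + 4 / a * (Real.exp (a / 2) - Real.exp (-(a / 2))) ^ 2 * (a ^ 2 / (4 * π ^ 2)) ^ (J + 1)
                * (1 / (1 + 4 * freq a n ^ 2))) / (m₀ : ℝ) ^ (2 * J + 1))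
        + ∑ x : Fin 4 × Fin (D + 1), if E₀ < (x.2 : ℕ) then
          |(fun t d ↦ (![fun d : ℕ ↦ (∑ j ∈ (Finset.range J).filter (fun j ↦ (2 * j + 1) = d),
                π / 4 * ((-1 : ℝ) ^ n * (n : ℝ) ^ (2 * j)) / Real.pi)
              + (∑ p ∈ (Finset.Icc 1 K ×ˢ Finset.range J).filter (fun p ↦ p.1 + (2 * p.2 + 1) = d),
                  (fun N : ℕ ↦ (if N % 4 = 1 then (1 : ℝ) else if N % 4 = 3 then -1 else 0)
              * (1 - 1 / (2 * (N : ℝ))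
                  - (∑ l ∈ Finset.Icc 1 ν, (bernoulli (2 * l) : ℝ) / (2 * l) * 16 ^ l
                      * (((N - 1).choose (2 * l - 1) : ℕ) : ℝ)) / 2)
              * (a / (2 * π)) ^ N) p.1
                    * ((-1 : ℝ) ^ n * (n : ℝ) ^ (2 * p.2)) / Real.pi)
              - (∑ p ∈ (Finset.range R ×ˢ Finset.range J).filter (fun p ↦ (2 * p.1 + 1) + (2 * p.2 + 1) = d),
                  (fun r : ℕ ↦ (-1 : ℝ) ^ r *
              (∑' l : ℕ, Real.exp (-(2 * a * digammaNode l)) * digammaNode l ^ (2 * r)) * (a / π) ^ (2 * r + 1)) p.1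
                    * ((-1 : ℝ) ^ n * (n : ℝ) ^ (2 * p.2)) / Real.pi)
              + (∑ r ∈ (Finset.range J).filter (fun r ↦ (2 * r + 2) = d),
                  (fun r : ℕ ↦ (-1 : ℝ) ^ n *
              (-((n : ℝ) ^ (2 * r + 1)) * ((Complex.digamma (1 / 4 + ((freq a n : ℝ) : ℂ) / 2 * I)).im / 2
                  + (∑ k ∈ weilPrimeIndex a, (Λ k : ℝ) / Real.sqrt k * Real.sin (freq a n * Real.log k))
                  - archExpSumSin a n) / π
                + 4 / a * (Real.exp (a / 2) - Real.exp (-(a / 2))) ^ 2 * (-1 : ℝ) ^ r * (a ^ 2 / (4 * π ^ 2)) ^ (r + 1)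
                  * (1 / (1 + 4 * freq a n ^ 2)))) r),
                fun _ ↦ 0, fun _ ↦ 0,
                fun d : ℕ ↦ ∑ j ∈ (Finset.range J).filter (fun j ↦ (2 * j + 1) = d),
                ((-1 : ℝ) ^ n * (n : ℝ) ^ (2 * j)) / Real.pi] t) d) x.1 x.2| * (![(1 : ℝ), (m₀ : ℝ), ∑ n ∈ weilPrimeIndex a, (Λ n : ℝ) / Real.sqrt n, ∑ n ∈ weilPrimeIndex a, (Λ n : ℝ) / Real.sqrt n] x.1) / (m₀ : ℝ) ^ (x.2 : ℕ) else 0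

/-- The (tag, power)-coefficient function of the profile table row `j` BEFORE rescaling (only tag 0 is nonzero). -/
def rtabRawE (a : ℝ) (se : Finset ℕ) {re : ℕ} (coefe : Fin re → ℕ → ℝ) (j : Fin re) : Fin 4 → ℕ → ℝ :=
  fun t d ↦ (![fun d : ℕ ↦ ∑ p ∈ (se.sigma fun q ↦ Finset.range (q + 1)).filter (fun p ↦ p.2 + 1 = d),
              2 * coefe j p.1 * ((-1 : ℝ) ^ p.2 * (p.1.descFactorial p.2 : ℝ) * (a ^ (p.1 - p.2) - (-a) ^ (p.1 - p.2))
                * (a / π) ^ (p.2 + 1) * (I ^ (p.2 + 1)).re) / Real.sqrt (2 * a),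
              fun _ ↦ 0, fun _ ↦ 0, fun _ ↦ 0] t) d

/-- The door's `Rtabe` for the truncated rescaled families (verbatim from `cinf_facts_even_truncA`). -/
def rtabE (a : ℝ) (se : Finset ℕ) {re : ℕ} (coefe : Fin re → ℕ → ℝ) (E₀ m₀ : ℕ) : Fin re → Fin 4 × Fin E₀ → ℝ :=
  fun (j : Fin re) (x : Fin 4 × Fin E₀) ↦ ((![fun d : ℕ ↦ ∑ p ∈ (se.sigma fun q ↦ Finset.range (q + 1)).filter (fun p ↦ p.2 + 1 = d),
              2 * coefe j p.1 * ((-1 : ℝ) ^ p.2 * (p.1.descFactorial p.2 : ℝ) * (a ^ (p.1 - p.2) - (-a) ^ (p.1 - p.2))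
                * (a / π) ^ (p.2 + 1) * (I ^ (p.2 + 1)).re) / Real.sqrt (2 * a),
              fun _ ↦ 0, fun _ ↦ 0, fun _ ↦ 0] x.1) ((x.2 : ℕ) + 1) / (m₀ : ℝ) ^ ((x.2 : ℕ) + 1))

variable (a : ℝ) (ν K R J D E₀ m₀ : ℕ)

/-- `prowE` through `prowRawE`. -/
theorem prowE_apply (n : ℕ) (x : Fin 4 × Fin E₀) :
    prowE a ν K R J E₀ m₀ n x = prowRawE a ν K R J n x.1 ((x.2 : ℕ) + 1) / (m₀ : ℝ) ^ ((x.2 : ℕ) + 1) := rfl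

/-- Tag 0 (pure powers) of `prowRawE`: the fiber sum boxed by `CinfCoeff.mem_evenRowPureBox`. -/
theorem prowRawE_tag0 (n d : ℕ) : prowRawE a ν K R J n 0 d = (∑ j ∈ (Finset.range J).filter (fun j ↦ (2 * j + 1) = d),
                  π / 4 * ((-1 : ℝ) ^ n * (n : ℝ) ^ (2 * j)) / Real.pi)
                + (∑ p ∈ (Finset.Icc 1 K ×ˢ Finset.range J).filter (fun p ↦ p.1 + (2 * p.2 + 1) = d),
                    (fun N : ℕ ↦ (if N % 4 = 1 then (1 : ℝ) else if N % 4 = 3 then -1 else 0)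
                * (1 - 1 / (2 * (N : ℝ))
                    - (∑ l ∈ Finset.Icc 1 ν, (bernoulli (2 * l) : ℝ) / (2 * l) * 16 ^ l
                        * (((N - 1).choose (2 * l - 1) : ℕ) : ℝ)) / 2)
                * (a / (2 * π)) ^ N) p.1
                      * ((-1 : ℝ) ^ n * (n : ℝ) ^ (2 * p.2)) / Real.pi)
                - (∑ p ∈ (Finset.range R ×ˢ Finset.range J).filter (fun p ↦ (2 * p.1 + 1) + (2 * p.2 + 1) = d),
                    (fun r : ℕ ↦ (-1 : ℝ) ^ r *
                (∑' l : ℕ, Real.exp (-(2 * a * digammaNode l)) * digammaNode l ^ (2 * r)) * (a / π) ^ (2 * r + 1)) p.1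
                      * ((-1 : ℝ) ^ n * (n : ℝ) ^ (2 * p.2)) / Real.pi)
                + (∑ r ∈ (Finset.range J).filter (fun r ↦ (2 * r + 2) = d),
                    (fun r : ℕ ↦ (-1 : ℝ) ^ n *
                (-((n : ℝ) ^ (2 * r + 1)) * ((Complex.digamma (1 / 4 + ((freq a n : ℝ) : ℂ) / 2 * I)).im / 2
                    + (∑ k ∈ weilPrimeIndex a, (Λ k : ℝ) / Real.sqrt k * Real.sin (freq a n * Real.log k))
                    - archExpSumSin a n) / π
                  + 4 / a * (Real.exp (a / 2) - Real.exp (-(a / 2))) ^ 2 * (-1 : ℝ) ^ r * (a ^ 2 / (4 * π ^ 2)) ^ (r + 1)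
                    * (1 / (1 + 4 * freq a n ^ 2)))) r) := rfl

/-- Tag 1 (`log m`) of `prowRawE` vanishes. -/
theorem prowRawE_tag1 (n d : ℕ) : prowRawE a ν K R J n 1 d = 0 := rfl

/-- Tag 2 (`−C_m`) of `prowRawE` vanishes. -/
theorem prowRawE_tag2 (n d : ℕ) : prowRawE a ν K R J n 2 d = 0 := rfl

/-- Tag 3 (`S_m`) of `prowRawE`: the fiber sum boxed by `CinfCoeff.mem_evenRowSinBox`. -/
theorem prowRawE_tag3 (n d : ℕ) : prowRawE a ν K R J n 3 d = ∑ j ∈ (Finset.range J).filter (fun j ↦ (2 * j + 1) = d),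
                  ((-1 : ℝ) ^ n * (n : ℝ) ^ (2 * j)) / Real.pi := rfl

/-- `rhoRowE` = analytic remainder + truncation tail written with `prowRawE`. -/
theorem rhoRowE_eq (n : ℕ) : rhoRowE a ν K R J D E₀ m₀ n = (((4 * Real.pi ^ 2 / 3 * ((2 * ν + 1).factorial : ℝ) / (2 * Real.pi) ^ (2 * ν + 1)
                * (4 * (1 / (4 * (π * m₀ / a / 2)))) ^ (2 * ν)
              + (1 / (4 * (π * m₀ / a / 2))) ^ (K + 1) / ((K + 1) * (1 - 1 / (4 * (π * m₀ / a / 2))))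
              + 2 * (1 / (4 * (π * m₀ / a / 2))) ^ (K + 1)
              + ∑ k ∈ Finset.Icc 1 ν, |(bernoulli (2 * k) : ℝ) / (2 * k)| * 2 ^ (K + 1 + 4 * k)
                  * (1 / (4 * (π * m₀ / a / 2))) ^ (K + 1)) / 2
            + (∑' k : ℕ, Real.exp (-(2 * a * digammaNode k)) * digammaNode k ^ (2 * R))
                / |π * m₀ / a| ^ (2 * R + 1)) / π
            * ∑ j ∈ Finset.range J, (n : ℝ) ^ (2 * j) / (m₀ : ℝ) ^ (2 * j + 1)
          + (2 * (π / 4 + (∑ k ∈ weilPrimeIndex a, (Λ k : ℝ) / Real.sqrt k) + a * (1 + weilArchDensity (2 * a)) / π)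
                * (n : ℝ) ^ (2 * J) / π
              + 4 / a * (Real.exp (a / 2) - Real.exp (-(a / 2))) ^ 2 * (a ^ 2 / (4 * π ^ 2)) ^ (J + 1)
                * (1 / (1 + 4 * freq a n ^ 2))) / (m₀ : ℝ) ^ (2 * J + 1))
        + ∑ x : Fin 4 × Fin (D + 1), if E₀ < (x.2 : ℕ) then
          |prowRawE a ν K R J n x.1 x.2| * (![(1 : ℝ), (m₀ : ℝ), ∑ n ∈ weilPrimeIndex a, (Λ n : ℝ) / Real.sqrt n, ∑ n ∈ weilPrimeIndex a, (Λ n : ℝ) / Real.sqrt n] x.1) / (m₀ : ℝ) ^ (x.2 : ℕ) else 0 := rfl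

/-- `rtabE` through `rtabRawE`. -/
theorem rtabE_apply (se : Finset ℕ) {re : ℕ} (coefe : Fin re → ℕ → ℝ) (j : Fin re) (x : Fin 4 × Fin E₀) :
    rtabE a se coefe E₀ m₀ j x = rtabRawE a se coefe j x.1 ((x.2 : ℕ) + 1) / (m₀ : ℝ) ^ ((x.2 : ℕ) + 1) := rfl

/-- Tag 0 of `rtabRawE`: the profile's Fourier fiber sum (`evenVTable_family`). -/
theorem rtabRawE_tag0 (se : Finset ℕ) {re : ℕ} (coefe : Fin re → ℕ → ℝ) (j : Fin re) (d : ℕ) :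
    rtabRawE a se coefe j 0 d = ∑ p ∈ (se.sigma fun q ↦ Finset.range (q + 1)).filter (fun p ↦ p.2 + 1 = d),
                2 * coefe j p.1 * ((-1 : ℝ) ^ p.2 * (p.1.descFactorial p.2 : ℝ) * (a ^ (p.1 - p.2) - (-a) ^ (p.1 - p.2))
                  * (a / π) ^ (p.2 + 1) * (I ^ (p.2 + 1)).re) / Real.sqrt (2 * a) := rfl

/-- Tags 1, 2, 3 of `rtabRawE` vanish. -/
theorem rtabRawE_tag_succ (se : Finset ℕ) {re : ℕ} (coefe : Fin re → ℕ → ℝ) (j : Fin re) (d : ℕ) :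
    rtabRawE a se coefe j 1 d = 0 ∧ rtabRawE a se coefe j 2 d = 0 ∧ rtabRawE a se coefe j 3 d = 0 :=
  ⟨rfl, rfl, rfl⟩

end CinfFam

variable {a : ℝ}

set_option maxHeartbeats 400000 in
/-- **`cinf_facts_even_truncA` through the names** `CinfFam.prowE / rhoRowE / rtabE`: the C∞ doors' `hρrowe ∧ hrowe ∧ hVe ∧ hWe`
(the door infers `Prowe := CinfFam.prowE a ν K R J E₀ m₀`, `ρrowe := CinfFam.rhoRowE a ν K R J D E₀ m₀`,
`Rtabe := CinfFam.rtabE a se coefe E₀ m₀` from it when passed `_`). -/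
theorem cinf_facts_even_truncA_fam (ha : 0 < a) {Be re m₀ : ℕ} (hm₀ : 2 ≤ π * m₀ / a) (hB2 : 2 * Be ≤ m₀) (hm₀2 : 2 ≤ m₀)
    (se : Finset ℕ) (coefe : Fin re → ℕ → ℝ)
    {ν : ℕ} (hν : ν ≠ 0) {K : ℕ} (hK : 2 * ν ≤ K) {R J E D : ℕ} (hE1 : E + 1 ≤ 2 * ν)
    (hE2 : E ≤ K) (hE3 : E ≤ 2 * R) (hEJ : E ≤ 2 * J) (hD1 : K + 2 * J ≤ D + 1) (hD2 : 2 * R + 2 * J ≤ D + 2)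
    {E₀ : ℕ} (hE0 : E + 1 ≤ E₀) (hE0D : E₀ ≤ D) (hDq : ∀ q ∈ se, q + 1 ≤ E₀) :
    -- hρrowe
    (∀ n : ℕ, 0 ≤ CinfFam.rhoRowE a ν K R J D E₀ m₀ n)
    ∧ -- hrowe
    (∀ m, m₀ ≤ m → ∀ n, n ≤ Be →
      |(if n = 0 then gramCoeff a 0 m else if m = 0 then gramCoeff a n 0
          else (gramCoeff a n m + gramCoeff a n (-(m : ℤ))) / 2)
        - (-1 : ℝ) ^ m * ∑ f : Fin 4 × Fin E₀, CinfFam.prowE a ν K R J E₀ m₀ n f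
            * (fun (x : Fin 4 × Fin E₀) (m : ℕ) ↦ ![(1 : ℝ), Real.log m, -(∑ n ∈ weilPrimeIndex a, (Λ n : ℝ) / Real.sqrt n * Real.cos (π * m / a * Real.log n)), (∑ n ∈ weilPrimeIndex a, (Λ n : ℝ) / Real.sqrt n * Real.sin (π * m / a * Real.log n))] x.1 * ((m₀ : ℝ) / (m : ℝ)) ^ ((x.2 : ℕ) + 1)) f m|
        ≤ CinfFam.rhoRowE a ν K R J D E₀ m₀ n * (fun m : ℕ ↦ ((m₀ : ℝ) / m) ^ (E + 1)) m)
    ∧ -- hVe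
    (∀ m, m₀ ≤ m → ∀ j : Fin re,
      (if m = 0 then (1 : ℝ) else 2) * (Yoshida1992.fourierCoeff a m
          ((Icc (-a) a).indicator fun x : ℝ ↦ ∑ q ∈ se, ((coefe j q : ℝ) : ℂ) * ((x : ℂ)) ^ q)).re / Real.sqrt (2 * a)
        = (-1 : ℝ) ^ m * ∑ f : Fin 4 × Fin E₀, CinfFam.rtabE a se coefe E₀ m₀ j f
            * (fun (x : Fin 4 × Fin E₀) (m : ℕ) ↦ ![(1 : ℝ), Real.log m, -(∑ n ∈ weilPrimeIndex a, (Λ n : ℝ) / Real.sqrt n * Real.cos (π * m / a * Real.log n)), (∑ n ∈ weilPrimeIndex a, (Λ n : ℝ) / Real.sqrt n * Real.sin (π * m / a * Real.log n))] x.1 * ((m₀ : ℝ) / (m : ℝ)) ^ ((x.2 : ℕ) + 1)) f m)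
    ∧ -- hWe
    (∀ N, ∑ m ∈ Ico m₀ N, ((fun m : ℕ ↦ ((m₀ : ℝ) / m) ^ (E + 1)) m) ^ 2
        ≤ (m₀ : ℝ) ^ (2 * E + 2) / ((2 * E + 1 : ℝ) * (((m₀ - 1 : ℕ) : ℝ)) ^ (2 * E + 1))) := by
  exact cinf_facts_even_truncA ha hm₀ hB2 hm₀2 se coefe hν hK hE1 hE2 hE3 hEJ hD1 hD2 hE0 hE0D hDq

end Summit.RiemannHypothesis.RiemannHypothesis.Theorems.WeilFormatC

end
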